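import Summits.CriticalPhenomena.Ising3DConformalLimit.Theses.ReflectionTwin
import Summits.CriticalPhenomena.Ising3DConformalLimit.Theorems.MarkovRigidityCubicSymmetryOfLimit
import HarnessLib
import HarnessLib.Audit

/-!
# Birth skeleton (BC3) for crux `TwinRotationGlue` — item stmt-CriticalPhenomena-16913, route `ReflectionTwin`, rank 5

Registered file `Cruxes/TwinRotationGlue/Lines/birth.lean` (planner-skel-stmt-CriticalPhenomena-16913-0, 2026-08-17).

## READ FIRST — the crux is closable NOW from the tree (no stub needed)

`ReflectionTwin.TwinRotationGlue` (grounded g65-0, refuter-reviewed rreview-0816T21-1-0) says: for every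
normalised, continuous-on-`NonCoincident`, non-degenerate, translation-invariant, scale-covariant pointwise
limit `(ρ, Δ, S)` of `criticalCorr 3`, blind transparency of the (111) reflection twin (some seam coupling
`J`, some linear `A` fixing the plane, preserving the upper half-space) implies `IsRotationInvariant S`.
Since 2026-08-16 the tree PROVES isotropy of every such limit outright: item 1980
`HyperoctahedralRP.LimitRotationInvariant` (`Cruxes.LimitRotationInvariant.QuarterTurnLiouville.LimitRotationInvariant_of`,
commit b509d2f177bd) applied to item 1979 `HyperoctahedralRP.HRP2Rigidity`
(`Cruxes.HRP2Rigidity.XRayMellin.HRP2Rigidity_of`).  Hence the crux follows by INSTANTIATION, ignoring both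
the twin hypothesis and continuity:

  intro ρ Δ S hρ hlim hnorm _ hnd htr hsc _
  exact LimitRotationInvariant_of HRP2Rigidity_of ρ Δ S hρ hlim hnorm hnd htr hsc

— checked sorry-free on the farm (rc 0, axioms `propext / Classical.choice / Quot.sound`) and published as
`Cruxes/TwinRotationGlue/TreeProof.lean` (NOT imported here, so that the BC3 probes of this skeleton stay
meaningful).  A PROVER SHOULD CLOSE stmt-16913 BY LANDING THAT THREE-LINE PROOF under
`Theorems/ReflectionTwinTwinRotationGlue.lean --workitem stmt-CriticalPhenomena-16913`.  (Route-level
consequence for the tenure planner, flagged in the registrar's NOTES/DONE: once the glue closes this way,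
`TwinThreshold` / `TwinTransparency` no longer bear load in `closes` — exactly the case "LimitRotationInvariant
proved elsewhere moots the route's own cruxes but not its dividends" foreseen in the route's KILL CRITERIA.)

## THE LINE registered here = the route's OWN mechanism (independent of the nine-mirror OS machinery)

The crux's documented proof is the composition of the route's four supports; one of them,
`CubicSymmetryOfLimit` (shared item 6229), is a tree theorem (`MarkovRigidityCubicSymmetry.cubicSymmetryOfLimit_proof`)
and is used BY NAME below; the other three are the registered stubs, each the route's open SUPPORT ITEM by name
(so each stub discharges by name the day its item lands):

* STUB 1 `stub_twinReflectionSymmetry : ReflectionTwin.TwinReflectionSymmetry` (item 16908; size M) — lattice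
  `θ`-symmetry of the twin: `τ` (negation off the plane, identity on it) is an automorphism of the weighted twin
  graph on every centred box, so the box-sup twin correlators of `σ_{−z₁}⋯σ_{−z_k}` and `σ_{z₁}⋯σ_{z_k}` agree
  for sites off the plane (`PairIsing.gibbsAvg_comp_equiv_of_invariant` box by box).
* STUB 2 `stub_twinTransfer : ReflectionTwin.TwinTransfer` (item 16909; size M–L; LOAD-BEARING for this line) —
  blind transparency through `A` + lattice `τ`-symmetry ⇒ `S_k ∘ θ = S_k` for all `k`: the copy sites satisfy
  `site(θv) = −site(v)` exactly off the plane, so `S_k(A♯x) = S_k(A♯θx)`; at `k = 2` the PROVED two-point isotropy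
  (`twoPointLimitIsotropic_proof`, `twoPointKernelOfLimit_proof`) pins `B := Aθ` to an orthogonal map fixing the
  plane pointwise, `B ∈ {id, θ}`, and `B = id` would make `A = θ` swap the half-spaces — so `A = id`.
* STUB 3 `stub_mirrorClosure : ReflectionTwin.MirrorClosure` (item 16910; size M) — pure group theory +
  topology: a family vanishing off `NonCoincident`, continuous on it, `B₃`-invariant and `θ`-invariant is
  `O(3)`-invariant (closed stabiliser; `θ∘s_{e₀}` is a rotation by an angle with `cos = −1/3`, irrational to `π`
  by Niven; dense powers; `⟨B₃, θ⟩` dense in `O(3)`; in-tree helpers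
  `Literature.Geometry.Euclidean.subgroup_eq_top_of_axisRotations / apply_comp_eq_of_axisRotations`).

COMPOSITION (`TwinRotationGlue_of`, kernel-checked, no `sorry` of its own; hypotheses = the three stub
signatures): unfold the crux, take `(ρ, Δ, S)` with its seven hypotheses and the transparency witness
`⟨J, A, hfix, hup, hconv⟩`; `B₃`-invariance from `cubicSymmetryOfLimit_holds`; `θ`-invariance from STUB 2 fed
with `⟨J, A, hfix, hup, hconv, STUB 1 at J⟩`; conclude with STUB 3.  Five lines of logic (this is the
planner's `glue_of_supports` of the route-opening session, evidence `evidence_Sketch2.lean`, re-derived).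

DISPROOF USED.  No `Cruxes/TwinRotationGlue/Disproof.lean` exists (crux directory empty at registration); no
`Negative/` lemma for any decl of `ReflectionTwin`; `ledger negatives --problem CriticalPhenomena` (11 entries,
2026-08-17): none in this sub-problem, none resembling a stub.  The refuter's mutation note on the crux
(continuity on `NonCoincident` used twice — closed stabiliser in MirrorClosure; `q →` plane point in
TwinTransfer) is honoured: STUB 3 carries the continuity hypothesis explicitly; STUB 2 is the item AS FILED
(its `k = 2` kernel continuity comes from `twoPointKernelOfLimit_proof`, not from a hypothesis).

BC3 PROBES (planner folder `bc/probes_*.lean`; the route file AND the landed theorems of items 1979/1980/6229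
imported, i.e. adversarial scope): for each stub signature `T`, `T → ReflectionTwin.TwinRotationGlue` and
`T → Ising3DConformalLimit` by `first | exact? | simpa | aesop` FAIL 6/6 (unsolved goals; `aesop: failed to
prove the goal after exhaustive search`); the unfolded variants of BC.md (`simpa [crux] | (unfold crux; simpa)
| (unfold crux; aesop)`, and `unfold + intro` then `exact? | aesop`) FAIL 9/9 (exhaustive-search failures or
deterministic time-outs at 400000 heartbeats).  No stub is cheaply the crux or the summit: STUB 1 is a
lattice identity with no limit in it, STUB 2 concludes only `θ`-invariance, STUB 3 is model-free group
theory; the summit needs existence, inversion covariance and `U₄ ≢ 0` on top.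

Sorries: exactly three, inside `stub_twinReflectionSymmetry`, `stub_twinTransfer`, `stub_mirrorClosure`.
-/

noncomputable section

namespace Summit.CriticalPhenomena.Ising3DConformalLimit.Cruxes.TwinRotationGlue.Birth

open scoped BigOperators Topology Classical
open Filter Set
open Literature.Probability.LatticeModels
open Summit.CriticalPhenomena.Ising3DConformalLimit.Theses

/-! ## The three registered stubs (the only `sorry`s of the file) — the route's support items BY NAME -/

/-- **STUB 1 — `TwinReflectionSymmetry` (support item stmt-CriticalPhenomena-16908) BY NAME.**  For every seam
coupling `J`, every `k` and all lattice sites `z₁ … z_k` off the plane `h z = z 0 + z 1 + z 2 ≠ 0`, the box-sup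
twin correlator of `σ_{−z₁} ⋯ σ_{−z_k}` equals that of `σ_{z₁} ⋯ σ_{z_k}`: `τ` (negation off the plane, identity
on it) maps n.n. bonds to n.n. bonds, seam bonds `{c, c − eᵢ}` to seam bonds `{c, eᵢ − c}` and fixes the seam
weights, so `PairIsing.gibbsAvg_comp_equiv_of_invariant` applies on every centred box (size M; provable now).
[cite: FrohlichEtAl1978, §3 Thm 3.1 (site-plane reflections)] -/
theorem stub_twinReflectionSymmetry : ReflectionTwin.TwinReflectionSymmetry := by
  sorry

/-- **STUB 2 — `TwinTransfer` (support item stmt-CriticalPhenomena-16909) BY NAME; load-bearing for this line.**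
For a normalised, non-degenerate, translation-invariant, scale-covariant pointwise limit `(ρ, Δ, S)` of
`criticalCorr 3`: if the `ρ`-renormalised twin correlators at some seam coupling `J` converge, locally uniformly
off the plane, to `S_k` read through some linear `A` above the plane (`A = id` on the plane, `A` preserves the
upper half-space), and the twin is `τ`-symmetric at the lattice level, then `S_k (θ ∘ w) = S_k w` for all `k, w`
(`θ` = the reflection in the plane `x₀ + x₁ + x₂ = 0`).  Why plausibly true: `site(θv) = −site(v)` exactly off
the plane, so the two nets coincide and `S_k(A♯x) = S_k(A♯θx)`; at `k = 2` the proved two-point isotropy pins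
`Aθ` to an orthogonal map fixing the plane pointwise, hence `A = id` (size M–L).
[cite: DKKMO2020Rotational, §1.2 (blind/aware transfer architecture)] [cite: Beffara2008, §2] -/
theorem stub_twinTransfer : ReflectionTwin.TwinTransfer := by
  sorry

/-- **STUB 3 — `MirrorClosure` (support item stmt-CriticalPhenomena-16910) BY NAME.**  A correlation family on
`ℝ³` that vanishes off `NonCoincident`, is continuous on `NonCoincident`, invariant under the hyperoctahedral
group `B₃` (linear isometries permuting `{±eᵢ}`) and under the reflection `θ` in the plane `x₀ + x₁ + x₂ = 0` is
`O(3)`-invariant (`IsRotationInvariant`).  Why plausibly true: the stabiliser is a closed subgroup of `O(3)`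
containing the rotation `θ ∘ s_{e₀}` about `(0,1,−1)` with `cos = −1/3` — an irrational multiple of `π` by
Niven's theorem (Mathlib `niven`) — hence all rotations about that axis, their `B₃`-conjugates, `SO(3)`, and
`θ ∉ SO(3)` gives `O(3)` (size M; in-tree helpers `Literature.Geometry.Euclidean.subgroup_eq_top_of_axisRotations`).
[cite: FrancescoMathieuSenechal1997, §4.3.1] -/
theorem stub_mirrorClosure : ReflectionTwin.MirrorClosure := by
  sorry

/-! ## The fourth support is a tree theorem -/

/-- **`CubicSymmetryOfLimit` (shared item stmt-CriticalPhenomena-6229) holds** — it is, verbatim, the proved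
item of route `MarkovRigidity` (`MarkovRigidityCubicSymmetry.cubicSymmetryOfLimit_proof`): every normalised,
non-degenerate, translation-invariant, scale-covariant pointwise limit of `criticalCorr 3` is `B₃`-invariant.
[cite: FriedliVelenik2017, Exercise 3.14] -/
theorem cubicSymmetryOfLimit_holds : ReflectionTwin.CubicSymmetryOfLimit :=
  Summit.CriticalPhenomena.Ising3DConformalLimit.MarkovRigidityCubicSymmetry.cubicSymmetryOfLimit_proof

/-! ## The composition: the three stub signatures imply the crux, by name (real proof, no `sorry`) -/

/-- **THE SKELETON THEOREM** — `ReflectionTwin.TwinRotationGlue` from the three registered stub signatures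
(`stub_twinReflectionSymmetry`, `stub_twinTransfer`, `stub_mirrorClosure`, in this order).  Unfold the crux;
take `(ρ, Δ, S)` with its hypotheses and the transparency witness `⟨J, A, hfix, hup, hconv⟩`; `B₃`-invariance
of `S` from the tree (`cubicSymmetryOfLimit_holds`); `θ`-invariance of `S` from STUB 2 fed with the witness and
STUB 1 at `J`; `O(3)`-invariance from STUB 3.
[cite: DKKMO2020Rotational, §1.2] [cite: FrohlichEtAl1978, §3 Thm 3.1] -/
theorem TwinRotationGlue_of (hτ : ReflectionTwin.TwinReflectionSymmetry) (hT : ReflectionTwin.TwinTransfer)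
    (hM : ReflectionTwin.MirrorClosure) : ReflectionTwin.TwinRotationGlue := by
  intro ρ Δ S hρ hlim hnorm hcont hnd htr hsc hex
  obtain ⟨J, A, hAfix, hAup, hconv⟩ := hex
  -- B₃ symmetry of the limit (tree theorem, item 6229)
  have hB := cubicSymmetryOfLimit_holds ρ Δ S hρ hlim hnorm hnd htr hsc
  -- θ-invariance of the limit: transfer (STUB 2) of the lattice θ-symmetry of the twin (STUB 1)
  have hθ := hT ρ Δ S hρ hlim hnorm hnd htr hsc ⟨J, A, hAfix, hAup, hconv, fun k z hz => hτ J k z hz⟩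
  -- ⟨B₃, θ⟩ is dense in O(3) and the stabiliser is closed (STUB 3)
  exact hM S hnorm hcont hB hθ

end Summit.CriticalPhenomena.Ising3DConformalLimit.Cruxes.TwinRotationGlue.Birth

end
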